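import Summits.CriticalPhenomena.PercolationContinuityZ3.Theorems.PercNearOneGluingNoHeavyLowerTailKnQuestion8CoefficientwiseCoreClassKernelMixDigonClusters

/-!
# Digon removal, part 2: an explicit bundle whose last thread has length 2

Support file (`--supports stmt-CriticalPhenomena-4575`, closed), prover `prim-cplus-coupling` (gen 70).  No definitions, no named facts, no sorries;
standard axioms.  Memo `prim-cplus-coupling/A5-COUPLING-gen70.md` §8, `THEOREM-IET-DIGON.md`.

Setting: an explicit bundle with `r + 1` threads in the lane's standing format (`ends, L, w, e, u, b, A`), whose LAST thread (index `r`) is a digon: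
`L r = 2`, middle vertex `m = w r 1`, edges `e₁ = e r 1 = um`, `e₂ = e r 2 = mb`; `E'` is the edge set of the first `r` threads and `E` that of all
`r + 1`.  We record the elementary facts used by the digon removal theorem: the ends of `e₁, e₂`; `m ∉ {u, b}`, `u ≠ b`; `e₁ ≠ e₂`, `e₁, e₂ ∉ E'`,
`E = insert e₁ (insert e₂ E')`; no edge of `E'` meets `m`; and the resulting CLUSTER IDENTITIES for the four colour states of the digon
(`DigonClusters`): with `C(S) = openCluster (ends '' S) u`,
  `C(ω ∪ {e₁}) = C(ω) ∪ {m}`, `C(ω ∪ {e₂}) = C(ω) ∪ {m | b ∈ C(ω)}`, `C(ω ∪ {e₁, e₂}) = C(ends '' ω ∪ {ub}) ∪ {m}` for every `ω ⊆ E'`.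
[cite: KozmaNitzan2024, Questions 8–9 (§5.5 p. 36) (context); Harris 1960]
-/

namespace Summit.CriticalPhenomena.PercolationContinuityZ3.Theorems.Coefficientwise.DigonSlices

open Finset Literature.Probability.Percolation DigonClusters

variable {ι V : Type*}

/-- **Ends of the digon edges**: `ends (e r 1) = s(u, w r 1)` and `ends (e r 2) = s(w r 1, b)`. -/
theorem digon_ends (ends : ι → Sym2 V) (r : ℕ) (L : ℕ → ℕ) (w : ℕ → ℕ → V) (e : ℕ → ℕ → ι) (u b : V)
    (hw0 : ∀ t, t < r + 1 → w t 0 = u) (hwL : ∀ t, t < r + 1 → w t (L t) = b)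
    (harc : ∀ t, t < r + 1 → ∀ j, 1 ≤ j → j ≤ L t → ends (e t j) = s(w t (j - 1), w t j))
    (hdig : L r = 2) :
    ends (e r 1) = s(u, w r 1) ∧ ends (e r 2) = s(w r 1, b) := by
  have hr : r < r + 1 := Nat.lt_succ_self r
  refine ⟨?_, ?_⟩
  · have := harc r hr 1 le_rfl (by omega)
    rw [this, hw0 r hr]
  · have := harc r hr 2 (by omega) (by omega)
    rw [this, show (2 : ℕ) - 1 = 1 from rfl, ← hdig, hwL r hr]

/-- **The digon vertex is not a hub, and the hubs differ**: `w r 1 ≠ u`, `w r 1 ≠ b`, `u ≠ b`. -/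
theorem digon_vertex_ne (r : ℕ) (L : ℕ → ℕ) (w : ℕ → ℕ → V) (u b : V)
    (hw0 : ∀ t, t < r + 1 → w t 0 = u) (hwL : ∀ t, t < r + 1 → w t (L t) = b)
    (hwinj : ∀ t, t < r + 1 → ∀ i j, i ≤ L t → j ≤ L t → w t i = w t j → i = j)
    (hdig : L r = 2) :
    w r 1 ≠ u ∧ w r 1 ≠ b ∧ u ≠ b := by
  have hr : r < r + 1 := Nat.lt_succ_self r
  refine ⟨?_, ?_, ?_⟩
  · intro h
    have := hwinj r hr 1 0 (by omega) (by omega) (h.trans (hw0 r hr).symm); omega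
  · intro h
    have := hwinj r hr 1 (L r) (by omega) le_rfl (h.trans (hwL r hr).symm); omega
  · intro h
    have := hwinj r hr 0 (L r) (by omega) le_rfl ((hw0 r hr).trans (h.trans (hwL r hr).symm)); omega

/-- **No edge of the other threads meets the digon vertex** (`m = w r 1` lies on thread `r` only, and is not a hub). -/
theorem digon_vertex_fresh (ends : ι → Sym2 V) (r : ℕ) (L : ℕ → ℕ)
    (w : ℕ → ℕ → V) (e : ℕ → ℕ → ι)
    (harc : ∀ t, t < r + 1 → ∀ j, 1 ≤ j → j ≤ L t → ends (e t j) = s(w t (j - 1), w t j))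
    (hcross : ∀ t t', t < r + 1 → t' < r + 1 → t ≠ t' → ∀ i j, i ≤ L t → j ≤ L t' → w t i = w t' j → (i = 0 ∧ j = 0) ∨ (i = L t ∧ j = L t'))
    (A : ℕ → Finset ι) (hA : ∀ t, t < r + 1 → ∀ i, i ∈ A t ↔ ∃ j, 1 ≤ j ∧ j ≤ L t ∧ e t j = i)
    (E' : Finset ι) (hEA' : ∀ i, i ∈ E' ↔ ∃ t, t < r ∧ i ∈ A t) (hdig : L r = 2) :
    ∀ z ∈ (ends '' (↑E' : Set ι)), w r 1 ∉ z := by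
  rintro z ⟨i, hi, rfl⟩ hm
  obtain ⟨t, ht, hit⟩ := (hEA' i).mp (Finset.mem_coe.mp hi)
  obtain ⟨j, hj1, hjL, rfl⟩ := (hA t (by omega) _).mp hit
  rw [harc t (by omega) j hj1 hjL] at hm
  have hne : r ≠ t := by omega
  rcases Sym2.mem_iff.mp hm with h | h
  · rcases hcross r t (Nat.lt_succ_self r) (by omega) hne 1 (j - 1) (by omega) (by omega) h with ⟨h1, _⟩ | ⟨h1, _⟩ <;> omega
  · rcases hcross r t (Nat.lt_succ_self r) (by omega) hne 1 j (by omega) hjL h with ⟨h1, _⟩ | ⟨h1, _⟩ <;> omega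

/-- **The edge set splits off the digon**: `e r 1 ≠ e r 2`, both lie outside `E'`, and `E = insert (e r 1) (insert (e r 2) E')`. -/
theorem digon_edges [DecidableEq ι] (ends : ι → Sym2 V) (r : ℕ) (L : ℕ → ℕ) (w : ℕ → ℕ → V) (e : ℕ → ℕ → ι) (u b : V)
    (hw0 : ∀ t, t < r + 1 → w t 0 = u) (hwL : ∀ t, t < r + 1 → w t (L t) = b)
    (harc : ∀ t, t < r + 1 → ∀ j, 1 ≤ j → j ≤ L t → ends (e t j) = s(w t (j - 1), w t j))
    (hwinj : ∀ t, t < r + 1 → ∀ i j, i ≤ L t → j ≤ L t → w t i = w t j → i = j)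
    (A : ℕ → Finset ι) (hA : ∀ t, t < r + 1 → ∀ i, i ∈ A t ↔ ∃ j, 1 ≤ j ∧ j ≤ L t ∧ e t j = i)
    (hAdisj : ∀ t t', t < r + 1 → t' < r + 1 → t ≠ t' → Disjoint (A t) (A t'))
    (E E' : Finset ι) (hEA : ∀ i, i ∈ E ↔ ∃ t, t < r + 1 ∧ i ∈ A t) (hEA' : ∀ i, i ∈ E' ↔ ∃ t, t < r ∧ i ∈ A t)
    (hdig : L r = 2) :
    e r 1 ≠ e r 2 ∧ e r 1 ∉ E' ∧ e r 2 ∉ E' ∧ E = insert (e r 1) (insert (e r 2) E') := by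
  have hr : r < r + 1 := Nat.lt_succ_self r
  obtain ⟨he1, he2⟩ := digon_ends ends r L w e u b hw0 hwL harc hdig
  obtain ⟨hmu, hmb, hub⟩ := digon_vertex_ne r L w u b hw0 hwL hwinj hdig
  have hne : e r 1 ≠ e r 2 := by
    intro h
    have : s(u, w r 1) = s(w r 1, b) := by rw [← he1, ← he2, h]
    rcases Sym2.eq_iff.mp this with ⟨h1, _⟩ | ⟨h1, _⟩
    · exact hmu h1.symm
    · exact hub h1
  have hAr : ∀ i, i ∈ A r ↔ i = e r 1 ∨ i = e r 2 := by
    intro i; rw [hA r hr]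
    constructor
    · rintro ⟨j, hj1, hjL, rfl⟩
      have : j = 1 ∨ j = 2 := by omega
      rcases this with rfl | rfl
      · exact Or.inl rfl
      · exact Or.inr rfl
    · rintro (rfl | rfl)
      · exact ⟨1, le_rfl, by omega, rfl⟩
      · exact ⟨2, by omega, by omega, rfl⟩
  have hnot : ∀ i, i ∈ A r → i ∉ E' := by
    intro i hi hiE
    obtain ⟨t, ht, hit⟩ := (hEA' i).mp hiE
    exact Finset.disjoint_left.mp (hAdisj r t hr (by omega) (by omega)) hi hit
  refine ⟨hne, hnot _ ((hAr _).mpr (Or.inl rfl)), hnot _ ((hAr _).mpr (Or.inr rfl)), ?_⟩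
  ext i
  rw [hEA i, Finset.mem_insert, Finset.mem_insert, hEA' i]
  constructor
  · rintro ⟨t, ht, hit⟩
    by_cases htr : t = r
    · subst htr
      rcases (hAr i).mp hit with h | h
      · exact Or.inl h
      · exact Or.inr (Or.inl h)
    · exact Or.inr (Or.inr ⟨t, by omega, hit⟩)
  · rintro (h | h | ⟨t, ht, hit⟩)
    · exact ⟨r, hr, (hAr i).mpr (Or.inl h)⟩
    · exact ⟨r, hr, (hAr i).mpr (Or.inr h)⟩
    · exact ⟨t, by omega, hit⟩

/-- **The four cluster identities of the digon states** (red side; the blue side is the same statement for the complementary colouring).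
For `ω ⊆ E'` (edges of the other threads), with `m = w r 1`, `e₁ = e r 1`, `e₂ = e r 2` and `C(S) = openCluster S u`:
`C(ends '' (ω ∪ {e₁})) = C(ends '' ω) ∪ {m}`,  `C(ends '' (ω ∪ {e₂})) = C(ends '' ω) ∪ {m | b ∈ C(ends '' ω)}`,
`C(ends '' (ω ∪ {e₁, e₂})) = C(ends '' ω ∪ {ub}) ∪ {m}`. -/
theorem digon_clusters [DecidableEq ι] (ends : ι → Sym2 V) (r : ℕ) (L : ℕ → ℕ)
    (w : ℕ → ℕ → V) (e : ℕ → ℕ → ι) (u b : V)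
    (hw0 : ∀ t, t < r + 1 → w t 0 = u) (hwL : ∀ t, t < r + 1 → w t (L t) = b)
    (harc : ∀ t, t < r + 1 → ∀ j, 1 ≤ j → j ≤ L t → ends (e t j) = s(w t (j - 1), w t j))
    (hwinj : ∀ t, t < r + 1 → ∀ i j, i ≤ L t → j ≤ L t → w t i = w t j → i = j)
    (hcross : ∀ t t', t < r + 1 → t' < r + 1 → t ≠ t' → ∀ i j, i ≤ L t → j ≤ L t' → w t i = w t' j → (i = 0 ∧ j = 0) ∨ (i = L t ∧ j = L t'))
    (A : ℕ → Finset ι) (hA : ∀ t, t < r + 1 → ∀ i, i ∈ A t ↔ ∃ j, 1 ≤ j ∧ j ≤ L t ∧ e t j = i)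
    (E' : Finset ι) (hEA' : ∀ i, i ∈ E' ↔ ∃ t, t < r ∧ i ∈ A t) (hdig : L r = 2)
    (ω : Finset ι) (hω : ω ⊆ E') :
    openCluster (ends '' (↑(insert (e r 1) ω) : Set ι)) u = insert (w r 1) (openCluster (ends '' (↑ω : Set ι)) u) ∧
    openCluster (ends '' (↑(insert (e r 2) ω) : Set ι)) u =
        openCluster (ends '' (↑ω : Set ι)) u ∪ {v | v = w r 1 ∧ b ∈ openCluster (ends '' (↑ω : Set ι)) u} ∧
    openCluster (ends '' (↑(insert (e r 1) (insert (e r 2) ω)) : Set ι)) u =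
        insert (w r 1) (openCluster (insert s(u, b) (ends '' (↑ω : Set ι))) u) := by
  obtain ⟨he1, he2⟩ := digon_ends ends r L w e u b hw0 hwL harc hdig
  obtain ⟨hmu, hmb, hub⟩ := digon_vertex_ne r L w u b hw0 hwL hwinj hdig
  have hfreshE := digon_vertex_fresh ends r L w e harc hcross A hA E' hEA' hdig
  have hfresh : ∀ z ∈ (ends '' (↑ω : Set ι)), w r 1 ∉ z := fun z hz =>
    hfreshE z (Set.image_mono (Finset.coe_subset.mpr hω) hz)
  have i1 : (ends '' (↑(insert (e r 1) ω) : Set ι)) = insert s(u, w r 1) (ends '' (↑ω : Set ι)) := by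
    rw [Finset.coe_insert, Set.image_insert_eq, he1]
  have i2 : (ends '' (↑(insert (e r 2) ω) : Set ι)) = insert s(w r 1, b) (ends '' (↑ω : Set ι)) := by
    rw [Finset.coe_insert, Set.image_insert_eq, he2]
  have i12 : (ends '' (↑(insert (e r 1) (insert (e r 2) ω)) : Set ι)) = insert s(u, w r 1) (insert s(w r 1, b) (ends '' (↑ω : Set ι))) := by
    rw [Finset.coe_insert, Set.image_insert_eq, he1, Finset.coe_insert, Set.image_insert_eq, he2]
  refine ⟨?_, ?_, ?_⟩
  · rw [i1]; exact openCluster_insert_rootLeaf_set _ u (w r 1) hmu hfresh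
  · rw [i2]; exact openCluster_insert_farLeaf_set _ u (w r 1) b hmu hmb hfresh
  · rw [i12]; exact openCluster_subdivide _ u (w r 1) b hmu hmb hub hfresh

end Summit.CriticalPhenomena.PercolationContinuityZ3.Theorems.Coefficientwise.DigonSlices
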